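import Summits.ABC.IUTFork.Cor312VolumesRealFrames
import HarnessLib

/-!
# [IUTchIII] Cor. 3.12, frames setting — factor log-moduli are MULTIPLICATIVE and contracting elements have
# NEGATIVE log-modulus; dilated hull-sets have unboundedly negative GENUINE log-volume

PROOF-ONLY support piece of the abc-iut cell (Cor. 3.12 cone, D-0067; ADJUDICATION-SPEC §2 (G3) «REAL-CONTAINER»
clause; seat abc-iut-w4-d036, gen 2, WAVE-4, home layer L6; CLAIM on HOME/STATUS 2026-08-26T01:44:51Z). Part 1 of 2
(`Cor312FactorVolumeDilates` ⟵ `Cor312SmallStableFrames`). TAKES NO SIDE on [IUTchIII] Cor. 3.12; 0 `def`s,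
0 `Prop` facts.

* §1 `FactorVolume` calculus over abc-iut-c312-6's `Cor312VolumesRealFrames` ([AbsTopIII] Prop. 5.7 (i)(b),
  (ii)(b) pp. 137–138): MULTIPLICATIVITY of `μ̇^log` at the two concrete factor volumes —
  `ofUltrametric_mulLogvol_mul` (`μ̇^log_K = log ∘ mod_K`, the modulus `distribHaarChar K` is a homomorphism;
  campaign-S `mulLogVolume_eq_log_distribHaarChar`) and `complexRadial_mulLogvol_mul` (`= log ‖·‖`); a
  CONTRACTING element has NEGATIVE `μ̇^log`: `ofUltrametric_mulLogvol_le_neg_log_two` (`0 < ‖x‖ < 1 ⇒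
  mod_K(x) = [𝒪_K : x·𝒪_K]⁻¹ ≤ 1/2`, the tree's `distribHaarChar_uniformizer` / `two_le_resIndex` — GENUINE Haar
  measure, no model volume), `complexRadial_mulLogvol_neg_of_norm_lt_one`; the power law from multiplicativity
  for ANY factor volume (`mulLogvol_pow_of_mul`).
* §2 `FrameVolumePieces`: from c312-6's closed form `μ^log(e⁻¹(λ·𝒪_L)) = Σ_i w_i·μ̇^log_i(λ_i)`
  (`logvol_preimage_hullSet`, [IUTchIII] Rmk. 3.9.5 (iii)) under multiplicative factor volumes:
  `logvol_preimage_hullSet_mul`, `logvol_preimage_hullSet_pow_mul`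
  (`μ^log(e⁻¹((tᴺ·λ)·𝒪_L)) = Σ_i w_i·μ̇^log_i(λ_i) + N·Σ_i w_i·μ̇^log_i(t_i)`), and **`exists_pow_logvol_lt`** — if
  `Σ_i w_i·μ̇^log_i(t_i) < 0` the power dilates have UNBOUNDEDLY NEGATIVE log-volume (the volume of `λ·𝒪_L` as
  `λ → 0`); `sum_mul_neg_of_nonpos_of_exists_neg` supplies that sign from factorwise data (nonnegative weights,
  nonpositive log-moduli, one negative at a positive weight — printed weights are positive, Rmk. 3.1.1 (ii)).
Consumed by part 2 to discharge the volume seam `hvol` of abc-iut-c312-9's `Cor312SmallStableReal` (p416160) /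
w5-d177's `SmallStableHullSets` at the frames setting. [cite: MochizukiAbsTopIII2015, Prop. 5.7 (i)(ii) pp. 137–138]
[claim: Mochizuki2012, status: disputed] for the quoted containers; the lemmas are classical measure theory.
-/

noncomputable section

open Set Function MeasureTheory Metric
open scoped Pointwise NNReal ENNReal

namespace Summit.ABC

namespace IUTFork

namespace Cor312Vol

open Thm311 Cor312 Cor312.Setting Literature.IUT.LogVolume Literature.IUT.LogThetaLattice
open Literature.NumberTheory.GaloisRepresentations.Ultrametric

/-! ## §1. Factor volumes: multiplicativity of `μ̇^log` and negativity at contracting elements -/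

namespace FactorVolume

/-- **Multiplicativity, nonarchimedean factor**: `μ̇^log_K(x·y) = μ̇^log_K(x) + μ̇^log_K(y)` (`x, y ≠ 0`) —
`μ̇^log_K = log ∘ mod_K` and the modulus is a homomorphism `K^× → ℝ_{>0}`.
[cite: MochizukiAbsTopIII2015, Prop. 5.7 (i)(b) p. 138] -/
theorem ofUltrametric_mulLogvol_mul (K : Type) [NontriviallyNormedField K] [IsUltrametricDist K]
    [ProperSpace K] [MeasurableSpace K] [BorelSpace K] {x y : K} (hx : x ≠ 0) (hy : y ≠ 0) :
    (ofUltrametric K).mulLogvol (x * y) = (ofUltrametric K).mulLogvol x + (ofUltrametric K).mulLogvol y := by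
  have key : ∀ u v : Kˣ, (ofUltrametric K).mulLogvol ((u : K) * v) =
      (ofUltrametric K).mulLogvol (u : K) + (ofUltrametric K).mulLogvol (v : K) := by
    intro u v
    rw [← Units.val_mul, ofUltrametric_mulLogvol, ofUltrametric_mulLogvol, ofUltrametric_mulLogvol,
      mulLogVolume_eq_log_distribHaarChar, mulLogVolume_eq_log_distribHaarChar,
      mulLogVolume_eq_log_distribHaarChar, map_mul, NNReal.coe_mul,
      Real.log_mul (NNReal.coe_pos.mpr distribHaarChar_pos).ne' (NNReal.coe_pos.mpr distribHaarChar_pos).ne']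
  exact key (Units.mk0 x hx) (Units.mk0 y hy)

/-- **A contracting element has log-modulus `≤ −log 2`**, nonarchimedean factor: for `0 < ‖x‖ < 1`,
`μ̇^log_K(x) = log mod_K(x) = −log [𝒪_K : x·𝒪_K] ≤ −log 2` (the index is `≥ 2` because `1 ∈ 𝒪_K ∖ x·𝒪_K`) —
GENUINE Haar measure. [cite: MochizukiAbsTopIII2015, Prop. 5.7 (i)(a)(b) pp. 137–138] -/
theorem ofUltrametric_mulLogvol_le_neg_log_two (K : Type) [NontriviallyNormedField K] [IsUltrametricDist K]
    [ProperSpace K] [MeasurableSpace K] [BorelSpace K] {x : K} (hx0 : x ≠ 0) (hx : ‖x‖ < 1) :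
    (ofUltrametric K).mulLogvol x ≤ -Real.log 2 := by
  set u : Kˣ := Units.mk0 x hx0 with hu
  have hux : (u : K) = x := rfl
  have hle : ‖(u : K)‖ ≤ 1 := by rw [hux]; exact hx.le
  have hlt : ‖(u : K)‖ < 1 := by rw [hux]; exact hx
  rw [← hux, ofUltrametric_mulLogvol, mulLogVolume_eq_log_distribHaarChar,
    distribHaarChar_uniformizer_real hle, Real.log_inv, neg_le_neg_iff]
  have h2 : (2 : ℝ) ≤ resIndex u := by exact_mod_cast two_le_resIndex hlt
  exact Real.log_le_log two_pos h2

/-- … in particular it is NEGATIVE. [cite: MochizukiAbsTopIII2015, Prop. 5.7 (i)(b) p. 138] -/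
theorem ofUltrametric_mulLogvol_neg_of_norm_lt_one (K : Type) [NontriviallyNormedField K]
    [IsUltrametricDist K] [ProperSpace K] [MeasurableSpace K] [BorelSpace K] {x : K} (hx0 : x ≠ 0)
    (hx : ‖x‖ < 1) : (ofUltrametric K).mulLogvol x < 0 :=
  (ofUltrametric_mulLogvol_le_neg_log_two K hx0 hx).trans_lt (neg_neg_of_pos (Real.log_pos one_lt_two))

/-- **Multiplicativity, archimedean (radial) factor**: `μ̇^log(x·y) = μ̇^log(x) + μ̇^log(y)` on `ℂ^×`
(`= log ‖·‖`). [cite: MochizukiAbsTopIII2015, Prop. 5.7 (ii)(b) p. 138] -/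
theorem complexRadial_mulLogvol_mul {x y : ℂ} (hx : x ≠ 0) (hy : y ≠ 0) :
    complexRadial.mulLogvol (x * y) = complexRadial.mulLogvol x + complexRadial.mulLogvol y := by
  rw [complexRadial_mulLogvol, complexRadial_mulLogvol, complexRadial_mulLogvol, norm_mul,
    Real.log_mul (norm_ne_zero_iff.mpr hx) (norm_ne_zero_iff.mpr hy)]

/-- A contracting element has NEGATIVE radial log-modulus: `‖x‖ < 1`, `x ≠ 0` ⇒ `log ‖x‖ < 0`.
[cite: MochizukiAbsTopIII2015, Prop. 5.7 (ii)(b) p. 138] -/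
theorem complexRadial_mulLogvol_neg_of_norm_lt_one {x : ℂ} (hx0 : x ≠ 0) (hx : ‖x‖ < 1) :
    complexRadial.mulLogvol x < 0 := by
  rw [complexRadial_mulLogvol]
  exact Real.log_neg (norm_pos_iff.mpr hx0) hx

/-- Multiplicativity on nonzero elements gives the power law `μ̇^log(xᴺ) = N·μ̇^log(x)` for ANY factor volume.
[cite: MochizukiAbsTopIII2015, Prop. 5.7 (i)(b) p. 138] -/
theorem mulLogvol_pow_of_mul {K : Type} [NormedField K] (μ : FactorVolume K)
    (hmul : ∀ x y : K, x ≠ 0 → y ≠ 0 → μ.mulLogvol (x * y) = μ.mulLogvol x + μ.mulLogvol y)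
    {x : K} (hx : x ≠ 0) (N : ℕ) : μ.mulLogvol (x ^ N) = N * μ.mulLogvol x := by
  induction N with
  | zero =>
    simp only [pow_zero, Nat.cast_zero, zero_mul]
    exact μ.mulLogvol_of_norm_eq_one norm_one
  | succ N ih =>
    rw [pow_succ, hmul _ _ (pow_ne_zero N hx) hx, ih, Nat.cast_succ]
    ring

end FactorVolume

/-- Elementary: a finite weighted sum with nonnegative weights, nonpositive terms, and ONE term negative at a
positive weight, is negative. [folklore] -/
theorem sum_mul_neg_of_nonpos_of_exists_neg {ι : Type} [Fintype ι] {w f : ι → ℝ}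
    (hw : ∀ i, 0 ≤ w i) (hf : ∀ i, f i ≤ 0) (h : ∃ i, 0 < w i ∧ f i < 0) :
    ∑ i, w i * f i < 0 := by
  classical
  obtain ⟨i₀, hw₀, hf₀⟩ := h
  have hle : ∀ i, w i * f i ≤ 0 := fun i => mul_nonpos_of_nonneg_of_nonpos (hw i) (hf i)
  have hlt : w i₀ * f i₀ < 0 := mul_neg_of_pos_of_neg hw₀ hf₀
  calc ∑ i, w i * f i = w i₀ * f i₀ + ∑ i ∈ Finset.univ.erase i₀, w i * f i :=
        (Finset.add_sum_erase _ _ (Finset.mem_univ i₀)).symm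
    _ < 0 + 0 := add_lt_add_of_lt_of_le hlt (Finset.sum_nonpos fun i _ => hle i)
    _ = 0 := add_zero 0

/-! ## §2. Frame volume pieces: the log-volume of dilated hull-sets -/

namespace FrameVolumePieces

variable {T : ThetaIndex} {L : LogShells T} (V : FrameVolumePieces L) (j : T.Label) (vQ : T.VQ)

/-- **Log-volume of a componentwise PRODUCT hull-set** under multiplicative factor volumes:
`μ^log(e⁻¹((a·λ)·𝒪_L)) = Σ_i w_i·μ̇^log_i(λ_i) + Σ_i w_i·μ̇^log_i(a_i)` (c312-6's closed form
`logvol_preimage_hullSet` + multiplicativity). [cite: Mochizuki2012, IUTchIII Rmk. 3.9.5 (iii) p. 128] -/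
theorem logvol_preimage_hullSet_mul
    (hmul : ∀ (i : V.J j vQ) (x y : V.K j vQ i), x ≠ 0 → y ≠ 0 →
      (V.vol j vQ i).mulLogvol (x * y) = (V.vol j vQ i).mulLogvol x + (V.vol j vQ i).mulLogvol y)
    (a c : ∀ i, V.K j vQ i) (ha : ∀ i, a i ≠ 0) (hc : ∀ i, c i ≠ 0) :
    V.logvol j vQ (V.e j vQ ⁻¹' hullSet (V.K j vQ) (fun i => a i * c i)) =
      (∑ i, V.w j vQ i * (V.vol j vQ i).mulLogvol (c i)) +
        ∑ i, V.w j vQ i * (V.vol j vQ i).mulLogvol (a i) := by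
  rw [V.logvol_preimage_hullSet j vQ, ← Finset.sum_add_distrib]
  refine Finset.sum_congr rfl fun i _ => ?_
  rw [hmul i _ _ (ha i) (hc i)]
  ring

/-- **Log-volume of the `N`-th power dilate**: `μ^log(e⁻¹((tᴺ·λ)·𝒪_L)) = Σ_i w_i·μ̇^log_i(λ_i) +
N·Σ_i w_i·μ̇^log_i(t_i)`. [cite: Mochizuki2012, IUTchIII Rmk. 3.9.5 (iii) p. 128] -/
theorem logvol_preimage_hullSet_pow_mul
    (hmul : ∀ (i : V.J j vQ) (x y : V.K j vQ i), x ≠ 0 → y ≠ 0 →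
      (V.vol j vQ i).mulLogvol (x * y) = (V.vol j vQ i).mulLogvol x + (V.vol j vQ i).mulLogvol y)
    (t c : ∀ i, V.K j vQ i) (ht : ∀ i, t i ≠ 0) (hc : ∀ i, c i ≠ 0) (N : ℕ) :
    V.logvol j vQ (V.e j vQ ⁻¹' hullSet (V.K j vQ) (fun i => t i ^ N * c i)) =
      (∑ i, V.w j vQ i * (V.vol j vQ i).mulLogvol (c i)) +
        N * ∑ i, V.w j vQ i * (V.vol j vQ i).mulLogvol (t i) := by
  rw [V.logvol_preimage_hullSet_mul j vQ hmul (fun i => t i ^ N) c (fun i => pow_ne_zero N (ht i)) hc,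
    Finset.mul_sum]
  congr 1
  refine Finset.sum_congr rfl fun i _ => ?_
  rw [FactorVolume.mulLogvol_pow_of_mul (V.vol j vQ i) (hmul i) (ht i) N]
  ring

/-- **Dilates of UNBOUNDEDLY NEGATIVE log-volume**: if `Σ_i w_i·μ̇^log_i(t_i) < 0` then for every bound `b`
some power dilate `e⁻¹((tᴺ·λ)·𝒪_L)` has log-volume `< b` (the volume of `λ·𝒪_L` as `λ → 0`).
[cite: Mochizuki2012, IUTchIII Rmk. 3.9.5 (iii) p. 128] -/
theorem exists_pow_logvol_lt
    (hmul : ∀ (i : V.J j vQ) (x y : V.K j vQ i), x ≠ 0 → y ≠ 0 →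
      (V.vol j vQ i).mulLogvol (x * y) = (V.vol j vQ i).mulLogvol x + (V.vol j vQ i).mulLogvol y)
    (t c : ∀ i, V.K j vQ i) (ht : ∀ i, t i ≠ 0) (hc : ∀ i, c i ≠ 0)
    (hneg : ∑ i, V.w j vQ i * (V.vol j vQ i).mulLogvol (t i) < 0) (b : ℝ) :
    ∃ N : ℕ, V.logvol j vQ (V.e j vQ ⁻¹' hullSet (V.K j vQ) (fun i => t i ^ N * c i)) < b := by
  set A : ℝ := ∑ i, V.w j vQ i * (V.vol j vQ i).mulLogvol (c i) with hA
  set B : ℝ := ∑ i, V.w j vQ i * (V.vol j vQ i).mulLogvol (t i) with hB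
  -- choose `N` with `N·(−B) > A − b`
  obtain ⟨N, hN⟩ := exists_nat_gt ((A - b) / (-B))
  refine ⟨N, ?_⟩
  rw [V.logvol_preimage_hullSet_pow_mul j vQ hmul t c ht hc N, ← hA, ← hB]
  have hB' : 0 < -B := neg_pos.mpr hneg
  have h1 : A - b < N * (-B) := by
    rw [div_lt_iff₀ hB'] at hN
    exact hN
  linarith

end FrameVolumePieces

end Cor312Vol

end IUTFork

end Summit.ABC

end
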